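import Summits.CriticalPhenomena.PercolationContinuityZ3.Theorems.PercNearOneGluingNoHeavyQuantTwoBlobAverageFloor
import Summits.CriticalPhenomena.PercolationContinuityZ3.Theorems.PercNearOneGluingNoHeavyQuantGluedTripleTrueFloor
import HarnessLib

/-!
# QUANT lane R8, T-DEC: THE GLUED PAIR WITH TWO DIFFERENT GATES `gate_{q₁} ρ ∗ gate_{q₂} ρ` IS SDEC AT ITS AVERAGE FLOOR `(q₁+q₂)g/2` — every
# shape `(r, k)`, all `0 < q₁, q₂ < 1` (prim-quant-census-2 gen 80)

builds on p205010 (kernel theorem, internal audit signed; external expert review pending)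

Support file (`--supports stmt-CriticalPhenomena-4575`), QUANT lane census seat prim-quant-census-2 (gen 80); memo
`run/shared/lean/prim/quant/prim-quant-census-2-g80/TRIPLE-G80.md` §6.  Theorems only, standard axioms, no sorries, no definitions.

**`sdec_gluedTwo_gates`**: `ρ = blobLaw [(k,g),(r,1)]`, `0 < q₁, q₂ < 1`, `0 < g < 1`:
`SDEC ((q₁+q₂)/2 · g) (2(r+k)) (gate_{q₁} ρ ∗ gate_{q₂} ρ)` — the AVERAGE floor (`sdec_gluedTwo`, g79, gives only `min(q₁,q₂)·g`); this is the
glued-sibling case of g79's Conjecture L (`GLUEDPAIR-G79 §9`: non-identical pairs at the average floor).  PROOF = the outer-gate mixture of width 2: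
for an outer gate `a` put `m = a(q₁+q₂)/2`; the law `gate_a(t₁ ∗ t₂)` EQUALS
* `m ≤ 1/2` (**`gate_gluedTwoGates_eq_mix_low`**): `(2q₁q₂/(q₁+q₂))·gate_m(ρ²) + (1 − 2q₁q₂/(q₁+q₂))·gate_{2m}(ρ)` — two gated blob laws;
* `m > 1/2` (**`gate_gluedTwoGates_eq_mix_high`**): `((1 − 2m + aq₁q₂)/(1−m))·gate_m(ρ²) + ((m − aq₁q₂)/(1−m))·(ρ ∗ gate_{2m−1} ρ)` — the second is
  the lift of `…QuantTwoBlobAverageFloor` (two blobs at their average gate + shifts), **`decAtT_comp2_lift`**; `1 − 2m + aq₁q₂ ≥ (1−q₁)(1−q₂) ≥ 0`.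
Each component is `DECAtT (m·g) (2m(r+kg)) j` (**`decAtT_comp2_blob2`**, **`decAtT_comp2_blob1g`**); `decAtT_finite_mixture` reassembles.  The
binomial `t_m ∗ t_m` is not needed at width 2.

HONEST STATUS.  Same shape `(r,k)` for both siblings; `SiblingStep`, `FarTreeRow` OPEN; RATE class (log\*) / honest sentence of
`run/shared/lean/prim/quant/README.md` unchanged.  [this work].  Nothing here is cited as a published result.  The gluing rows served
[cite: KozmaNitzan2024, Conjecture 3 (p. 15)]; product measure [cite: Grimmett1999, §1.3 p. 10].
-/

noncomputable section

open scoped BigOperators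

namespace Summit.CriticalPhenomena.PercolationContinuityZ3.Theorems
namespace Quant
namespace LawDec

open Finset

/-! ### The components are DEC at floor `m·g`, target `2m(r+kg)`, at every layer below `2(r+k)` -/

/-- **component C₂**: `gate_m(ρ ∗ ρ)`, a gated blob law. [this work] -/
theorem decAtT_comp2_blob2 (r k : ℕ) {g m : ℝ} (hg0 : 0 < g) (hg1 : g < 1) (hm0 : 0 < m) (hm1 : m ≤ 1)
    (j : ℕ) (hj : j < (r + k) + (r + k)) :
    DECAtT (m * g) (2 * (m * ((r : ℝ) + k * g))) j ((r + k) + (r + k))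
      (gate (lconv (r + k) (r + k) (blobLaw [(k, g), (r, 1)]) (blobLaw [(k, g), (r, 1)])) m) := by
  obtain ⟨-, -, -, bmn, s2, -⟩ := glued_powers_facts r k hg0 hg1
  have d := s2 m hm0 hm1 j hj
  rw [decAt_iff_decAtT, sum_mul_gate, bmn] at d
  have e : m * (((r : ℝ) + k * g) + ((r : ℝ) + k * g)) = 2 * (m * ((r : ℝ) + k * g)) := by ring
  rwa [e] at d

/-- **component C₁**: `gate_e(ρ)` with `e = 2m ≤ 1` (used for `m ≤ 1/2`), via the floor `g/2`. [this work] -/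
theorem decAtT_comp2_blob1g (r k : ℕ) {g m e : ℝ} (hg0 : 0 < g) (hg1 : g < 1) (hm0 : 0 < m) (he : e = 2 * m) (he1 : e ≤ 1)
    (j : ℕ) :
    DECAtT (m * g) (2 * (m * ((r : ℝ) + k * g))) j ((r + k) + (r + k)) (gate (blobLaw [(k, g), (r, 1)]) e) := by
  obtain ⟨a0, aM, a1, amn⟩ := glued_blob_laws r k hg0.le hg1.le
  have he0 : 0 < e := by linarith
  have hx0 : 0 < g / 2 := by positivity
  have hρS : SDEC g (r + k) (blobLaw [(k, g), (r, 1)]) := by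
    have h := sdec_blobLaw g hg0 hg1 [((k : ℕ), g), (r, (1 : ℝ))] (fun p hp => by
      simp only [List.mem_cons, List.mem_nil_iff, or_false] at hp
      rcases hp with rfl | rfl
      · exact ⟨le_rfl, hg1.le⟩
      · exact ⟨hg1.le, le_rfl⟩)
    rwa [blobTop_glued] at h
  have s1' : SDEC (g / 2) (r + k) (blobLaw [(k, g), (r, 1)]) := sdec_mono hρS (by linarith) hg1
  have hr0 : (0 : ℝ) ≤ r := Nat.cast_nonneg r
  have hk0 : (0 : ℝ) ≤ k := Nat.cast_nonneg k
  have d : DECAt (e * (g / 2)) j (r + k) (gate (blobLaw [(k, g), (r, 1)]) e) := by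
    by_cases hjM : j < r + k
    · exact s1' e he0 he1 j hjM
    · refine decAt_gate_of_top_le _ _ (g / 2) e hx0.le (by nlinarith) he0.le he1 a0 aM a1 ?_ j (not_lt.1 hjM)
      rw [amn]; push_cast; nlinarith
  rw [decAt_iff_decAtT, sum_mul_gate, amn] at d
  have ef : e * (g / 2) = m * g := by rw [he]; ring
  have eT : e * ((r : ℝ) + k * g) = 2 * (m * ((r : ℝ) + k * g)) := by rw [he]; ring
  rw [ef, eT] at d
  exact decAtT_mono_top d (by omega)

/-- **component X₁**: `ρ ∗ gate_{2m−1} ρ` for `1/2 < m ≤ 1` — the lift of `…QuantTwoBlobAverageFloor` read at `c = 2m − 1`. [this work] -/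
theorem decAtT_comp2_lift (r k : ℕ) {g m : ℝ} (hg0 : 0 < g) (hg1 : g < 1) (hm : 1 / 2 < m) (hm1 : m ≤ 1) (j : ℕ) :
    DECAtT (m * g) (2 * (m * ((r : ℝ) + k * g))) j ((r + k) + (r + k))
      (lconv (r + k) (r + k) (blobLaw [(k, g), (r, 1)]) (gate (blobLaw [(k, g), (r, 1)]) (2 * m - 1))) := by
  have d := decAtT_oneSureOneGated r k hg0 hg1 (by linarith : 0 < 2 * m - 1) (by linarith : 2 * m - 1 ≤ 1) j
  have e1 : (1 + (2 * m - 1)) * g / 2 = m * g := by ring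
  have e2 : (1 + (2 * m - 1)) * ((r : ℝ) + k * g) = 2 * (m * ((r : ℝ) + k * g)) := by ring
  rwa [e1, e2] at d

/-! ### The outer-gate mixture identities of width 2 with two gates -/

/-- **MIXTURE, `m = a(q₁+q₂)/2 ≤ 1/2`**: `gate_a(t₁ ∗ t₂) = (2q₁q₂/(q₁+q₂))·gate_m(ρ²) + (1 − 2q₁q₂/(q₁+q₂))·gate_{2m}(ρ)` (`q₁ + q₂ ≠ 0`).
[this work] -/
theorem gate_gluedTwoGates_eq_mix_low (M : ℕ) (ρ : ℕ → ℝ) (hρM : ∀ h, M < h → ρ h = 0) (a q₁ q₂ : ℝ) (hq : q₁ + q₂ ≠ 0) (h : ℕ) :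
    gate (lconv M M (gate ρ q₁) (gate ρ q₂)) a h
      = (2 * q₁ * q₂ / (q₁ + q₂)) * gate (lconv M M ρ ρ) (a * (q₁ + q₂) / 2) h
        + (1 - 2 * q₁ * q₂ / (q₁ + q₂)) * gate ρ (a * (q₁ + q₂)) h := by
  rw [gate_apply, gate_apply, gate_apply, gatedPair_expand M ρ hρM q₁ q₂ h]
  field_simp
  ring

/-- **MIXTURE, `m = a(q₁+q₂)/2 > 1/2`**: `gate_a(t₁ ∗ t₂) = ((1 − 2m + aq₁q₂)/(1−m))·gate_m(ρ²) + ((m − aq₁q₂)/(1−m))·(ρ ∗ gate_{2m−1} ρ)`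
(`m ≠ 1`). [this work] -/
theorem gate_gluedTwoGates_eq_mix_high (M : ℕ) (ρ : ℕ → ℝ) (hρM : ∀ h, M < h → ρ h = 0) (a q₁ q₂ : ℝ)
    (hm : 1 - a * (q₁ + q₂) / 2 ≠ 0) (h : ℕ) :
    gate (lconv M M (gate ρ q₁) (gate ρ q₂)) a h
      = ((1 - a * (q₁ + q₂) + a * q₁ * q₂) / (1 - a * (q₁ + q₂) / 2)) * gate (lconv M M ρ ρ) (a * (q₁ + q₂) / 2) h
        + ((a * (q₁ + q₂) / 2 - a * q₁ * q₂) / (1 - a * (q₁ + q₂) / 2))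
          * lconv M M ρ (gate ρ (2 * (a * (q₁ + q₂) / 2) - 1)) h := by
  have hm' : 2 - a * (q₁ + q₂) ≠ 0 := by
    intro h0; apply hm; linear_combination h0 / 2
  rw [gate_apply, gate_apply, gatedPair_expand M ρ hρM q₁ q₂ h, lconv_gate_right M M ρ ρ _ hρM h]
  field_simp
  ring

/-! ### The glued pair with two gates at its average floor -/

/-- **THE GLUED PAIR WITH TWO GATES AT ITS AVERAGE FLOOR — EVERY SHAPE.**  `ρ = blobLaw [(k,g),(r,1)]`, `0 < q₁ < 1`, `0 < q₂ < 1`, `0 < g < 1`: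
`SDEC ((q₁+q₂)/2 · g) (2(r+k)) (gate_{q₁} ρ ∗ gate_{q₂} ρ)`. [this work] -/
theorem sdec_gluedTwo_gates (r k : ℕ) {q₁ q₂ g : ℝ} (hq₁0 : 0 < q₁) (hq₁1 : q₁ < 1) (hq₂0 : 0 < q₂) (hq₂1 : q₂ < 1) (hg0 : 0 < g)
    (hg1 : g < 1) :
    SDEC ((q₁ + q₂) / 2 * g) ((r + k) + (r + k))
      (lconv (r + k) (r + k) (gate (blobLaw [(k, g), (r, 1)]) q₁) (gate (blobLaw [(k, g), (r, 1)]) q₂)) := by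
  intro a ha0 ha1 j hj
  set ρ : ℕ → ℝ := blobLaw [(k, g), (r, 1)] with hρ
  have hq : q₁ + q₂ ≠ 0 := by linarith
  have hm0 : 0 < a * (q₁ + q₂) / 2 := by positivity
  have hm1 : a * (q₁ + q₂) / 2 < 1 := by nlinarith
  have hmne : 1 - a * (q₁ + q₂) / 2 ≠ 0 := by linarith
  -- laws and the mean of the pair
  obtain ⟨a0, aM, a1, amn⟩ := glued_blob_laws r k hg0.le hg1.le
  obtain ⟨u0, uM, u1⟩ := gate_laws (r + k) ρ q₁ hq₁0.le hq₁1.le a0 aM a1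
  obtain ⟨v0, vM, v1⟩ := gate_laws (r + k) ρ q₂ hq₂0.le hq₂1.le a0 aM a1
  have umn : ∑ h ∈ Finset.range (r + k + 1), (h : ℝ) * gate ρ q₁ h = q₁ * ((r : ℝ) + k * g) := by rw [sum_mul_gate, amn]
  have vmn : ∑ h ∈ Finset.range (r + k + 1), (h : ℝ) * gate ρ q₂ h = q₂ * ((r : ℝ) + k * g) := by rw [sum_mul_gate, amn]
  obtain ⟨p0, pM, p1, pmn⟩ := lconv_laws u0 u1 umn v0 v1 vmn
  rw [decAt_iff_decAtT, sum_mul_gate, pmn]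
  have eT : a * (q₁ * ((r : ℝ) + k * g) + q₂ * ((r : ℝ) + k * g)) = 2 * ((a * (q₁ + q₂) / 2) * ((r : ℝ) + k * g)) := by ring
  have ex : a * ((q₁ + q₂) / 2 * g) = (a * (q₁ + q₂) / 2) * g := by ring
  rw [eT, ex]
  have hC2 := decAtT_comp2_blob2 r k hg0 hg1 hm0 hm1.le j hj
  by_cases hcase : a * (q₁ + q₂) / 2 ≤ 1 / 2
  · -- two gated blob laws
    have hC1 := decAtT_comp2_blob1g r k hg0 hg1 hm0 (e := a * (q₁ + q₂)) (by ring) (by linarith) j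
    have hα0 : 0 ≤ 2 * q₁ * q₂ / (q₁ + q₂) := by positivity
    have hγ0 : 0 ≤ 1 - 2 * q₁ * q₂ / (q₁ + q₂) := by
      rw [sub_nonneg, div_le_one (by positivity)]; nlinarith
    refine decAtT_finite_mixture (ι := Fin 2) _ _ j _ _
      ![2 * q₁ * q₂ / (q₁ + q₂), 1 - 2 * q₁ * q₂ / (q₁ + q₂)]
      ![gate (lconv (r + k) (r + k) ρ ρ) (a * (q₁ + q₂) / 2), gate ρ (a * (q₁ + q₂))]
      ?_ ?_ (fun h => ?_) ?_
    · intro i; fin_cases i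
      · exact hα0
      · exact hγ0
    · rw [Fin.sum_univ_two]
      show 2 * q₁ * q₂ / (q₁ + q₂) + (1 - 2 * q₁ * q₂ / (q₁ + q₂)) = 1
      ring
    · rw [Fin.sum_univ_two]
      exact gate_gluedTwoGates_eq_mix_low (r + k) ρ aM a q₁ q₂ hq h
    · intro i hi
      fin_cases i
      · exact hC2
      · exact hC1
  · -- the gated pair blob law and the lift `ρ ∗ gate_{2m−1} ρ`
    have hcase' : 1 / 2 < a * (q₁ + q₂) / 2 := lt_of_not_ge hcase
    have hX := decAtT_comp2_lift r k hg0 hg1 hcase' hm1.le j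
    have hpos : 0 < 1 - a * (q₁ + q₂) / 2 := by linarith
    have hm2 : 2 - a * (q₁ + q₂) ≠ 0 := ne_of_gt (by linarith)
    have hα0 : 0 ≤ (1 - a * (q₁ + q₂) + a * q₁ * q₂) / (1 - a * (q₁ + q₂) / 2) := by
      refine div_nonneg ?_ hpos.le
      nlinarith [mul_pos (by linarith : 0 < 1 - q₁) (by linarith : 0 < 1 - q₂),
        mul_nonneg (by linarith : 0 ≤ 1 - a) (by nlinarith : 0 ≤ q₁ + q₂ - q₁ * q₂)]
    have hγ0 : 0 ≤ (a * (q₁ + q₂) / 2 - a * q₁ * q₂) / (1 - a * (q₁ + q₂) / 2) := by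
      refine div_nonneg ?_ hpos.le
      nlinarith [mul_nonneg ha0.le (by nlinarith : 0 ≤ q₁ + q₂ - 2 * q₁ * q₂)]
    refine decAtT_finite_mixture (ι := Fin 2) _ _ j _ _
      ![(1 - a * (q₁ + q₂) + a * q₁ * q₂) / (1 - a * (q₁ + q₂) / 2), (a * (q₁ + q₂) / 2 - a * q₁ * q₂) / (1 - a * (q₁ + q₂) / 2)]
      ![gate (lconv (r + k) (r + k) ρ ρ) (a * (q₁ + q₂) / 2), lconv (r + k) (r + k) ρ (gate ρ (2 * (a * (q₁ + q₂) / 2) - 1))]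
      ?_ ?_ (fun h => ?_) ?_
    · intro i; fin_cases i
      · exact hα0
      · exact hγ0
    · rw [Fin.sum_univ_two]
      show (1 - a * (q₁ + q₂) + a * q₁ * q₂) / (1 - a * (q₁ + q₂) / 2)
        + (a * (q₁ + q₂) / 2 - a * q₁ * q₂) / (1 - a * (q₁ + q₂) / 2) = 1
      field_simp
      ring
    · rw [Fin.sum_univ_two]
      exact gate_gluedTwoGates_eq_mix_high (r + k) ρ aM a q₁ q₂ hmne h
    · intro i hi
      fin_cases i
      · exact hC2
      · exact hX

end LawDec
end Quant
end Summit.CriticalPhenomena.PercolationContinuityZ3.Theorems
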